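import Summits.AtomisticToContinuum.Crystallization.Theses.SpectralChargeLedger
import Summits.AtomisticToContinuum.Crystallization.Theorems.OneMultiplierPricing.Negative.BarlowShellDilation

/-!
# Route `SpectralChargeLedger`, crux `SummedShellPricing` (stmt-AtomisticToContinuum-17044, K1),
# line `Sketch`: stub `stub_chartGoodShellGood` (sub-goal G1) — CHART-GOOD ⇒ SHELL-GOOD

For a cell `(a,h)` in K1's box (`47/50 ≤ a ≤ 1`, `|h − a√(2/3)| ≤ a/100`), a `δ`-separated
configuration `x : Fin N → ℝ³`, and tolerances `0 < θ ≤ τ`, `4θ < δ`, `θ ≤ 1/20`: if the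
radius-`4` neighbourhood of `x i` is two-way `θ`-matched, after a linear isometry `A`, with the
relaxed hcp point set `hcpStacking a h` (the `Good 4 θ i` of `HcpDefectCounting.HcpDefectCoercivity`),
then the open punctured `13/10·a`-shell `T := {x j ≠ x i : dist (x j) (x i) < 13/10·a}` is
`τ`-matched BIJECTIVELY, through the same `A`, to the hcp reference shell
`R := {p ∈ hcpStacking a h : p ≠ 0, ‖p‖ < 13/10·a}` (K1-goodness of site `i`, hcp branch).

PROOF.
* Box consequences (`box_bounds`): `0 < a`, `0 < h`, `74/100 ≤ min a h`,
  `max a √(a²/3+h²) ≤ 101/100·a`.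
* Shell enumeration in the WIDE window (`norm_le_of_mem_barlowStacking_wide`, ported from
  `OneMultiplierPricing.Negative.BarlowShellDilation.norm_le_of_mem_barlowStacking` with the window
  `13/10·a` widened to `34/25·a`, still below the second shell `min (2h, √(4a²/3+h²)) ≥ 1.4·a`):
  a stacking point of norm `< 34/25·a` has norm `≤ max a √(a²/3+h²)`; with uniform discreteness
  (`le_dist_of_mem_barlowStacking` against `0`) every non-zero such point has norm in
  `[74/100, 101/100·a]` (`norm_mem_Icc_of_mem_hcpStacking`).
* An abstract two-way matching lemma (`exists_equiv_of_two_way_matching`): if every `p ∈ R` is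
  `θ`-matched to some `z ∈ T` and conversely, and distinct points of `T`, resp. images `g p` of
  distinct points of `R`, are `> 2θ` apart, then choice gives a bijection `T ≃ R` along the matching.
* Instantiation (`exists_shellEquiv_of_chart`) with `g p := x i + A p`: reference shell points have
  norm `≤ 4`, their `θ`-matches `x j` satisfy `0 < 74/100 − θ ≤ dist (x j) (x i) ≤ 101/100·a + θ <
  13/10·a`; a shell point `x j` (`dist ≤ 4`) is `θ`-matched to a stacking point `p` of norm
  `< 13/10·a + θ < 34/25·a`, non-zero since `θ < δ ≤ dist (x j) (x i)`, hence `p ∈ R` by the wide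
  enumeration; separation: `δ > 4θ` on `T`, `min a h ≥ 74/100 > 2θ` on `R` (`A` is an isometry).
No definition, no named fact; all `[folklore]`.
-/

noncomputable section

namespace Summit.AtomisticToContinuum.Crystallization.Theorems.SummedShellPricingChartShell

open scoped BigOperators Classical
open Literature.MathematicalPhysics.StatisticalMechanics
open Summit.AtomisticToContinuum.Crystallization.Theorems.OneMultiplierPricing.Negative.BarlowShellDilation
  (norm_barlowPos_sq haggLabel_small)

/-! ## The reference shell: enumeration in the wide window and norm bounds -/

-- adapted from Summits/AtomisticToContinuum/Crystallization/Theorems/OneMultiplierPricing/Negative/BarlowShellDilation.lean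
-- (`norm_le_of_mem_barlowStacking`, window `13/10·a` widened to `34/25·a`)
/-- **Shell enumeration (norm part), wide window.** For a Hägg stacking with in-layer spacing
`a ≥ 47/50` and layer spacing `h` within `a/100` of the ideal `a√(2/3)`, every stacking point of
norm `< 34/25·a` has norm `≤ max a √(a²/3 + h²)`: in coordinates `‖p‖² = a²·q + k²h²` with
`q = i² + ij + j² + L(i+j) + L²/3`, `L = haggLabel s k`; for `k = 0` the integer `q < 2` is `≤ 1`,
for `k = ±1` (`L = ±1`) `q = m + 1/3` with the integer `m ≥ 0` forced to vanish
(`a² + a²/3 + h² > (34/25·a)²` as `h ≥ 79/100·a`), and `|k| ≥ 2` is impossible (`4h² > (34/25·a)²`).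
[folklore] -/
theorem norm_le_of_mem_barlowStacking_wide {a h : ℝ} (ha : 47 / 50 ≤ a)
    (hh : |h - a * Real.sqrt (2 / 3)| ≤ a / 100) {s : ℤ → ℤ} (hs : IsHaggSeq s)
    {p : EuclideanSpace ℝ (Fin 3)} (hp : p ∈ barlowStacking a h s) (hpn : ‖p‖ < 34 / 25 * a) :
    ‖p‖ ≤ max a (Real.sqrt (a ^ 2 / 3 + h ^ 2)) := by
  obtain ⟨k, i, j, rfl⟩ := hp
  have ha0 : 0 < a := by linarith
  -- bounds on h
  have hs23 : (4 : ℝ) / 5 < Real.sqrt (2 / 3) := by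
    rw [show (4 : ℝ) / 5 = Real.sqrt ((4 / 5) ^ 2) by rw [Real.sqrt_sq (by norm_num)]]
    exact Real.sqrt_lt_sqrt (by norm_num) (by norm_num)
  have hhlo : 79 / 100 * a ≤ h := by
    have := (abs_le.1 hh).1
    nlinarith
  have hh2 : 6241 / 10000 * a ^ 2 ≤ h ^ 2 := by nlinarith
  have hnsq := norm_barlowPos_sq a h s k i j
  have hn0 : 0 ≤ ‖barlowPos a h s k i j‖ := norm_nonneg _
  have hnsq_lt : ‖barlowPos a h s k i j‖ ^ 2 < (34 / 25 * a) ^ 2 :=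
    pow_lt_pow_left₀ hpn hn0 two_ne_zero
  set L : ℤ := haggLabel s k with hL
  by_cases hk : k ^ 2 ≤ 1
  · rcases haggLabel_small hs hk with ⟨rfl, hL0⟩ | ⟨hk1, hL1⟩
    · -- k = 0: norm² = a² (i² + ij + j²), an integer multiple of a², < 1.8496 a² ⇒ ≤ a²
      have hL0' : (L : ℝ) = 0 := by rw [hL, hL0]; simp
      set q : ℤ := i ^ 2 + i * j + j ^ 2 with hq
      have hnsq' : ‖barlowPos a h s 0 i j‖ ^ 2 = a ^ 2 * (q : ℝ) := by
        rw [hnsq, hL0', hq]; push_cast; ring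
      have hqlt : (q : ℝ) < 2 := by
        by_contra hcon
        have hcon' : (2 : ℝ) ≤ q := not_lt.mp hcon
        have : a ^ 2 * 2 ≤ a ^ 2 * (q : ℝ) := by nlinarith
        nlinarith
      have hq1 : q ≤ 1 := by
        have : q < 2 := by exact_mod_cast hqlt
        omega
      have hq1' : (q : ℝ) ≤ 1 := by exact_mod_cast hq1
      have hle : ‖barlowPos a h s 0 i j‖ ^ 2 ≤ a ^ 2 := by rw [hnsq']; nlinarith
      calc ‖barlowPos a h s 0 i j‖ ≤ a :=
            (pow_le_pow_iff_left₀ hn0 ha0.le two_ne_zero).1 (by simpa using hle)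
        _ ≤ max a (Real.sqrt (a ^ 2 / 3 + h ^ 2)) := le_max_left _ _
    · -- k = ±1: norm² = a² (m + 1/3) + h² with m a non-negative integer ⇒ m = 0
      have hk1' : (k : ℝ) ^ 2 = 1 := by exact_mod_cast hk1
      have hL1' : L = 1 ∨ L = -1 := by rw [hL]; exact hL1
      have hLsq : (L : ℝ) ^ 2 = 1 := by
        rcases hL1' with h1 | h1 <;> rw [h1] <;> norm_num
      set m : ℤ := i ^ 2 + i * j + j ^ 2 + L * (i + j) with hm
      have hm0 : 0 ≤ m := by
        rcases hL1' with h1 | h1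
        · have : 2 * m + 1 = (i + j + 1) ^ 2 + i ^ 2 + j ^ 2 := by rw [hm, h1]; ring
          nlinarith [sq_nonneg (i + j + 1), sq_nonneg i, sq_nonneg j]
        · have : 2 * m + 1 = (i + j - 1) ^ 2 + i ^ 2 + j ^ 2 := by rw [hm, h1]; ring
          nlinarith [sq_nonneg (i + j - 1), sq_nonneg i, sq_nonneg j]
      have hnsq' : ‖barlowPos a h s k i j‖ ^ 2 = a ^ 2 * (m : ℝ) + (a ^ 2 / 3 + h ^ 2) := by
        rw [hnsq, hm]; push_cast
        linear_combination (a ^ 2 / 3) * hLsq + h ^ 2 * hk1'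
      have hmlt : (m : ℝ) < 1 := by
        by_contra hcon
        have hcon' : (1 : ℝ) ≤ m := not_lt.mp hcon
        have : a ^ 2 * 1 ≤ a ^ 2 * (m : ℝ) := by nlinarith
        nlinarith
      have hm1 : m = 0 := by
        have : m < 1 := by exact_mod_cast hmlt
        omega
      have hm1' : (m : ℝ) = 0 := by exact_mod_cast hm1
      have heq : ‖barlowPos a h s k i j‖ ^ 2 = a ^ 2 / 3 + h ^ 2 := by rw [hnsq', hm1']; ring
      have : ‖barlowPos a h s k i j‖ = Real.sqrt (a ^ 2 / 3 + h ^ 2) := by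
        rw [← heq, Real.sqrt_sq hn0]
      rw [this]
      exact le_max_right _ _
  · -- |k| ≥ 2: norm ≥ 2h > 34/25·a
    exfalso
    have hk2 : (4 : ℤ) ≤ k ^ 2 := by
      rcases le_or_gt 2 k with h2 | h2
      · nlinarith
      rcases le_or_gt k (-2) with h3 | h3
      · nlinarith
      exfalso
      apply hk
      have hk1 : -1 ≤ k ∧ k ≤ 1 := by omega
      nlinarith [hk1.1, hk1.2]
    have hk4 : (4 : ℝ) ≤ (k : ℝ) ^ 2 := by exact_mod_cast hk2
    -- the in-layer quadratic part is non-negative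
    have hform : 0 ≤ (i : ℝ) ^ 2 + (i : ℝ) * j + (j : ℝ) ^ 2 + (L : ℝ) * ((i : ℝ) + j) +
        (L : ℝ) ^ 2 / 3 := by
      nlinarith [sq_nonneg ((i : ℝ) + (j : ℝ) / 2 + (L : ℝ) / 2), sq_nonneg ((j : ℝ) + (L : ℝ) / 3)]
    have : (k : ℝ) ^ 2 * h ^ 2 ≤ ‖barlowPos a h s k i j‖ ^ 2 := by
      rw [hnsq]; nlinarith
    nlinarith

/-- **Box consequences.** For `47/50 ≤ a` and `|h − a√(2/3)| ≤ a/100`: `0 < a`, `0 < h`,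
`74/100 ≤ min a h` and `max a √(a²/3 + h²) ≤ 101/100·a` (`4/5 < √(2/3) < 8165/10000`). [folklore] -/
theorem box_bounds {a h : ℝ} (ha : 47 / 50 ≤ a) (hh : |h - a * Real.sqrt (2 / 3)| ≤ a / 100) :
    0 < a ∧ 0 < h ∧ 74 / 100 ≤ min a h ∧ max a (Real.sqrt (a ^ 2 / 3 + h ^ 2)) ≤ 101 / 100 * a := by
  have ha0 : 0 < a := by linarith
  have hs23 : (4 : ℝ) / 5 < Real.sqrt (2 / 3) := by
    rw [show (4 : ℝ) / 5 = Real.sqrt ((4 / 5) ^ 2) by rw [Real.sqrt_sq (by norm_num)]]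
    exact Real.sqrt_lt_sqrt (by norm_num) (by norm_num)
  have hs_hi : Real.sqrt (2 / 3) < 8165 / 10000 := by
    rw [Real.sqrt_lt' (by norm_num)]; norm_num
  obtain ⟨hh1, hh2⟩ := abs_le.1 hh
  have hhlo : 79 / 100 * a ≤ h := by nlinarith
  have hhhi : h ≤ 8265 / 10000 * a := by nlinarith
  have hh0 : 0 < h := by linarith
  refine ⟨ha0, hh0, ?_, ?_⟩
  · rw [le_min_iff]; constructor <;> linarith
  · rw [max_le_iff]
    refine ⟨by linarith, ?_⟩
    rw [Real.sqrt_le_left (by positivity)]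
    nlinarith

/-- **Reference-shell norms.** For `47/50 ≤ a`, `|h − a√(2/3)| ≤ a/100`, a non-zero point of `hcpStacking a h` of norm
`< 34/25·a` has norm in `[74/100, 101/100·a]` (uniform discreteness against the stacking point `0`,
and the wide shell enumeration). [folklore] -/
theorem norm_mem_Icc_of_mem_hcpStacking {a h : ℝ} (ha : 47 / 50 ≤ a)
    (hh : |h - a * Real.sqrt (2 / 3)| ≤ a / 100) {p : EuclideanSpace ℝ (Fin 3)}
    (hp : p ∈ hcpStacking a h) (hp0 : p ≠ 0) (hpn : ‖p‖ < 34 / 25 * a) :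
    74 / 100 ≤ ‖p‖ ∧ ‖p‖ ≤ 101 / 100 * a := by
  obtain ⟨ha0, hh0, hmin, hmax⟩ := box_bounds ha hh
  have h0 : (0 : EuclideanSpace ℝ (Fin 3)) ∈ hcpStacking a h := ⟨0, 0, 0, by simp [barlowPos]⟩
  constructor
  · have := le_dist_of_mem_barlowStacking a h alternatingHagg ha0.le hh0.le hp h0 hp0
    rw [dist_zero_right] at this
    exact hmin.trans this
  · exact (norm_le_of_mem_barlowStacking_wide ha hh isHaggSeq_alternating hp hpn).trans hmax

/-! ## Two-way matching ⇒ bijection -/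

/-- **Two-way matching with separation gives a bijection.** If every `p ∈ R` has a `θ`-close
partner `z ∈ T` of `g p` and every `z ∈ T` is `θ`-close to some `g p`, `p ∈ R`, while distinct
points of `T` and images of distinct points of `R` are `> 2θ` apart, then the chosen partner map
`R → T` is a bijection and its inverse `e : T ≃ R` satisfies `dist t (g (e t)) ≤ θ`. [folklore] -/
theorem exists_equiv_of_two_way_matching {α β : Type*} [PseudoMetricSpace α] {T : Set α}
    {R : Set β} (g : β → α) {θ : ℝ}
    (H1 : ∀ p ∈ R, ∃ z ∈ T, dist z (g p) ≤ θ)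
    (H2 : ∀ z ∈ T, ∃ p ∈ R, dist z (g p) ≤ θ)
    (sepT : ∀ z ∈ T, ∀ z' ∈ T, z ≠ z' → 2 * θ < dist z z')
    (sepR : ∀ p ∈ R, ∀ p' ∈ R, p ≠ p' → 2 * θ < dist (g p) (g p')) :
    ∃ e : ↥T ≃ ↥R, ∀ t : ↥T, dist (t : α) (g (e t)) ≤ θ := by
  choose f hfT hfd using H1
  set F : ↥R → ↥T := fun p => ⟨f p p.2, hfT p p.2⟩ with hF
  have hinj : Function.Injective F := by
    intro p p' hpp'
    by_contra hne
    have hne' : (p : β) ≠ p' := fun h => hne (Subtype.ext h)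
    have hFeq : f p p.2 = f p' p'.2 := congrArg Subtype.val hpp'
    have hlt := sepR p p.2 p' p'.2 hne'
    have hle : dist (g p) (g p') ≤ 2 * θ :=
      calc dist (g p) (g p') ≤ dist (g p) (f p p.2) + dist (f p p.2) (g p') := dist_triangle _ _ _
        _ ≤ θ + θ := by
            refine add_le_add ?_ ?_
            · rw [dist_comm]; exact hfd p p.2
            · rw [hFeq]; exact hfd p' p'.2
        _ = 2 * θ := by ring
    exact absurd hle (not_le.2 hlt)
  have hsurj : Function.Surjective F := by
    intro z
    obtain ⟨p, hpR, hpd⟩ := H2 z z.2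
    refine ⟨⟨p, hpR⟩, ?_⟩
    by_contra hne
    have hne' : f p hpR ≠ (z : α) := fun h => hne (Subtype.ext h)
    have hlt := sepT _ (hfT p hpR) z z.2 hne'
    have hle : dist (f p hpR) (z : α) ≤ 2 * θ :=
      calc dist (f p hpR) (z : α) ≤ dist (f p hpR) (g p) + dist (g p) z := dist_triangle _ _ _
        _ ≤ θ + θ := add_le_add (hfd p hpR) (by rw [dist_comm]; exact hpd)
        _ = 2 * θ := by ring
    exact absurd hle (not_le.2 hlt)
  refine ⟨(Equiv.ofBijective F ⟨hinj, hsurj⟩).symm, fun t => ?_⟩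
  have hFt : F ((Equiv.ofBijective F ⟨hinj, hsurj⟩).symm t) = t :=
    Equiv.ofBijective_apply_symm_apply F ⟨hinj, hsurj⟩ t
  have hval : (t : α) = f _ ((Equiv.ofBijective F ⟨hinj, hsurj⟩).symm t).2 :=
    (congrArg Subtype.val hFt).symm
  rw [hval]
  exact hfd _ _

/-! ## The chart gives the matched shell -/

/-- **Chart ⇒ matched first shell (hcp, same isometry).** Under the box, separation and tolerance
hypotheses of `stub_chartGoodShellGood`, a two-way `θ`-chart `A` of the radius-`4` neighbourhood of
`x i` onto `hcpStacking a h` yields a bijection `e` from the open punctured `13/10·a`-shell of `x i`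
to the hcp reference shell with `dist (t − x i) (A (e t)) ≤ τ`. [folklore] -/
theorem exists_shellEquiv_of_chart {a h : ℝ} (hba : 47 / 50 ≤ a) (hba1 : a ≤ 1)
    (hbh : |h - a * Real.sqrt (2 / 3)| ≤ a / 100) {δ θ τ : ℝ} (hθ0 : 0 < θ) (hθτ : θ ≤ τ)
    (hθδ : 4 * θ < δ) (hθ20 : θ ≤ 1 / 20) {N : ℕ} (x : Fin N → EuclideanSpace ℝ (Fin 3))
    (hsep : ∀ i j : Fin N, i ≠ j → δ ≤ dist (x i) (x j)) (i : Fin N)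
    (A : EuclideanSpace ℝ (Fin 3) →ₗᵢ[ℝ] EuclideanSpace ℝ (Fin 3))
    (h1 : ∀ p ∈ hcpStacking a h, ‖p‖ ≤ 4 → ∃ j : Fin N, dist (x j) (x i + A p) ≤ θ)
    (h2 : ∀ j : Fin N, dist (x j) (x i) ≤ 4 → ∃ p ∈ hcpStacking a h, dist (x j) (x i + A p) ≤ θ) :
    ∃ e : ↥{z : EuclideanSpace ℝ (Fin 3) | z ∈ Set.range x ∧ z ≠ x i ∧ dist z (x i) < 13 / 10 * a} ≃
        ↥{p : EuclideanSpace ℝ (Fin 3) | p ∈ hcpStacking a h ∧ p ≠ 0 ∧ ‖p‖ < 13 / 10 * a},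
      ∀ t : ↥{z : EuclideanSpace ℝ (Fin 3) | z ∈ Set.range x ∧ z ≠ x i ∧ dist z (x i) < 13 / 10 * a},
        dist ((t : EuclideanSpace ℝ (Fin 3)) - x i)
          (A ((e t : ↥{p : EuclideanSpace ℝ (Fin 3) | p ∈ hcpStacking a h ∧ p ≠ 0 ∧ ‖p‖ < 13 / 10 * a}) :
            EuclideanSpace ℝ (Fin 3))) ≤ τ := by
  obtain ⟨ha0, hh0, hmin, -⟩ := box_bounds hba hbh
  have hg : ∀ p : EuclideanSpace ℝ (Fin 3), dist (x i + A p) (x i) = ‖p‖ := fun p => by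
    rw [dist_self_add_left, A.norm_map]
  have key := exists_equiv_of_two_way_matching
    (T := {z : EuclideanSpace ℝ (Fin 3) | z ∈ Set.range x ∧ z ≠ x i ∧ dist z (x i) < 13 / 10 * a})
    (R := {p : EuclideanSpace ℝ (Fin 3) | p ∈ hcpStacking a h ∧ p ≠ 0 ∧ ‖p‖ < 13 / 10 * a})
    (fun p => x i + A p) (θ := θ) ?_ ?_ ?_ ?_
  · obtain ⟨e, he⟩ := key
    exact ⟨e, fun t => by rw [dist_sub_eq_dist_add_left, add_comm]; exact (he t).trans hθτ⟩
  · -- every reference shell point is matched to a shell point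
    rintro p ⟨hp, hp0, hpn⟩
    show ∃ z ∈ {z : EuclideanSpace ℝ (Fin 3) | z ∈ Set.range x ∧ z ≠ x i ∧ dist z (x i) < 13 / 10 * a},
      dist z (x i + A p) ≤ θ
    have hpn' : ‖p‖ < 34 / 25 * a := by linarith
    obtain ⟨hplo, hphi⟩ := norm_mem_Icc_of_mem_hcpStacking hba hbh hp hp0 hpn'
    obtain ⟨j, hj⟩ := h1 p hp (by linarith)
    refine ⟨x j, ⟨⟨j, rfl⟩, ?_, ?_⟩, hj⟩
    · intro hji
      rw [hji, dist_comm, hg] at hj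
      linarith
    · have := dist_triangle (x j) (x i + A p) (x i)
      rw [hg] at this
      linarith
  · -- every shell point is matched to a reference shell point
    rintro z ⟨⟨j, rfl⟩, hne, hlt⟩
    show ∃ p ∈ {p : EuclideanSpace ℝ (Fin 3) | p ∈ hcpStacking a h ∧ p ≠ 0 ∧ ‖p‖ < 13 / 10 * a},
      dist (x j) (x i + A p) ≤ θ
    obtain ⟨p, hp, hpj⟩ := h2 j (by linarith)
    have hji : j ≠ i := fun hji => hne (by rw [hji])
    have hp0 : p ≠ 0 := by
      rintro rfl
      have := hsep j i hji
      rw [map_zero, add_zero] at hpj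
      linarith
    have hpn' : ‖p‖ < 34 / 25 * a := by
      have := dist_triangle (x i + A p) (x j) (x i)
      rw [hg, dist_comm] at this
      linarith
    obtain ⟨-, hphi⟩ := norm_mem_Icc_of_mem_hcpStacking hba hbh hp hp0 hpn'
    exact ⟨p, ⟨hp, hp0, by linarith⟩, hpj⟩
  · -- distinct shell points are `δ > 2θ` apart
    rintro z ⟨⟨j, rfl⟩, -, -⟩ z' ⟨⟨j', rfl⟩, -, -⟩ hne
    have hjj : j ≠ j' := fun hjj => hne (by rw [hjj])
    have := hsep j j' hjj
    linarith
  · -- images of distinct reference shell points are `min a h > 2θ` apart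
    rintro p ⟨hp, -, -⟩ p' ⟨hp', -, -⟩ hne
    show 2 * θ < dist (x i + A p) (x i + A p')
    rw [dist_add_left, A.dist_map]
    have := le_dist_of_mem_barlowStacking a h alternatingHagg ha0.le hh0.le hp hp' hne
    linarith

/-- **Sub-goal G1 — chart-good ⇒ shell-good (L, geometry).**  For a cell `(a,h)` in K1's box, a
`δ`-separated configuration `x` and `0 < θ ≤ τ`, `4θ < δ`, `θ ≤ 1/20`: if the radius-`4` neighbourhood
of `x i` is two-way `θ`-matched, after a linear isometry `A`, with the relaxed hcp point set
`(hcpPeriodicConfiguration ha hh).points = hcpStacking a h` (the `Good 4 θ i` of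
`HcpDefectCounting.HcpDefectCoercivity`), then the open punctured `13/10·a`-shell of `x i` is
`τ`-matched BIJECTIVELY to the hcp reference 12-shell (K1-good, hcp branch): reference shell points
have norm `≤ max a √(a²/3+h²) ≤ 1.01a` (`norm_le_of_mem_barlowStacking`) and `≥ min a h ≥ 0.74`
(`le_dist_of_mem_barlowStacking`), their `θ`-matches are distinct shell points (`2θ < δ`), and every
shell point is `θ`-matched to a stacking point of norm `< 13/10·a + θ < 1.39a`, which is non-zero
(`θ < δ`) and hence (shell enumeration extended to the window `1.39a`, below the second shell
`√(4a²/3+h²) ≥ 1.408a`) a reference shell point; the two matchings are mutually inverse by uniqueness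
(`2θ < δ`, `2θ < min a h`). [folklore] -/
theorem stub_chartGoodShellGood :
    ∀ (a h : ℝ) (ha : a ≠ 0) (hh : h ≠ 0), 47 / 50 ≤ a → a ≤ 1 → |h - a * Real.sqrt (2 / 3)| ≤ a / 100 →
    ∀ (δ θ τ : ℝ), 0 < θ → θ ≤ τ → 4 * θ < δ → θ ≤ 1 / 20 →
    ∀ (N : ℕ) (x : Fin N → EuclideanSpace ℝ (Fin 3)), (∀ i j : Fin N, i ≠ j → δ ≤ dist (x i) (x j)) →
    ∀ i : Fin N,
      (∃ A : EuclideanSpace ℝ (Fin 3) →ₗᵢ[ℝ] EuclideanSpace ℝ (Fin 3),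
        (∀ p ∈ (hcpPeriodicConfiguration ha hh).points, ‖p‖ ≤ 4 → ∃ j : Fin N, dist (x j) (x i + A p) ≤ θ) ∧
        (∀ j : Fin N, dist (x j) (x i) ≤ 4 →
          ∃ p ∈ (hcpPeriodicConfiguration ha hh).points, dist (x j) (x i + A p) ≤ θ)) →
      (∃ A : EuclideanSpace ℝ (Fin 3) →ₗᵢ[ℝ] EuclideanSpace ℝ (Fin 3),
            (∃ e : ↥{z : EuclideanSpace ℝ (Fin 3) | z ∈ Set.range x ∧ z ≠ x i ∧ dist z (x i) < 13 / 10 * a} ≃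
                ↥{p : EuclideanSpace ℝ (Fin 3) | p ∈ hcpStacking a h ∧ p ≠ 0 ∧ ‖p‖ < 13 / 10 * a},
              ∀ t : ↥{z : EuclideanSpace ℝ (Fin 3) | z ∈ Set.range x ∧ z ≠ x i ∧ dist z (x i) < 13 / 10 * a},
                dist ((t : EuclideanSpace ℝ (Fin 3)) - x i)
                  (A ((e t : ↥{p : EuclideanSpace ℝ (Fin 3) | p ∈ hcpStacking a h ∧ p ≠ 0 ∧ ‖p‖ < 13 / 10 * a}) : EuclideanSpace ℝ (Fin 3))) ≤ τ) ∨
            (∃ e : ↥{z : EuclideanSpace ℝ (Fin 3) | z ∈ Set.range x ∧ z ≠ x i ∧ dist z (x i) < 13 / 10 * a} ≃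
                ↥{p : EuclideanSpace ℝ (Fin 3) | p ∈ fccStacking a h ∧ p ≠ 0 ∧ ‖p‖ < 13 / 10 * a},
              ∀ t : ↥{z : EuclideanSpace ℝ (Fin 3) | z ∈ Set.range x ∧ z ≠ x i ∧ dist z (x i) < 13 / 10 * a},
                dist ((t : EuclideanSpace ℝ (Fin 3)) - x i)
                  (A ((e t : ↥{p : EuclideanSpace ℝ (Fin 3) | p ∈ fccStacking a h ∧ p ≠ 0 ∧ ‖p‖ < 13 / 10 * a}) : EuclideanSpace ℝ (Fin 3))) ≤ τ)) := by
  intro a h ha hh hba hba1 hbh δ θ τ hθ0 hθτ hθδ hθ20 N x hsep i hchart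
  obtain ⟨A, h1, h2⟩ := hchart
  rw [hcpPeriodicConfiguration_points] at h1 h2
  exact ⟨A, Or.inl (exists_shellEquiv_of_chart hba hba1 hbh hθ0 hθτ hθδ hθ20 x hsep i A h1 h2)⟩

end Summit.AtomisticToContinuum.Crystallization.Theorems.SummedShellPricingChartShell
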